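import Literature.Probability.Percolation.AdjFourArmCyclic
import HarnessLib

/-!
# Five arms with two opens and three closeds contain a cyclically adjacent four-arm family (proofs only)

Topic `Literature/Probability/Percolation`; family `crit-perc`. PROOFS ONLY (no definition, no
named fact). Serves the named fact `Literature.Probability.Percolation.Werner2009_lemma63`
through Nolin's Thm. 27 for the adjacent arrangement: the host-extension constant of the
arc-landed host needs a constant lower bound for the cyclically adjacent four-arm event
`adjFourArmCyc` (`AdjFourArmCyclic.lean`) across an annulus of bounded ratio, which the tree's
near-critical FIVE-arm lower bound `fiveArm_lowerBound` (`c (m/n)² ≤ P_t(armEvent ![T,F,T,F,F] m n)`)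
provides once five arms are shown to contain four cyclically adjacent ones:

* `armEvent_five_subset_adjFourArmCyc` — **`armEvent ![T,F,T,F,F] r R ⊆ adjFourArmCyc r R`**
  (`1 ≤ R`): read the outer extremities in the perimeter coordinate `hexPos R`; two of the three
  closed ones lie on the same side of the pair of open ones (pigeonhole), and with the two open
  arms they form four disjoint arms whose closed extremities do not separate the open ones
  (Nolin 2008, §4.1: the cyclic order of a sub-family is the induced one).

## References

* P. Nolin, Near-critical percolation in two dimensions, *Electron. J. Probab.* 13 (2008), §4.1
  (colour sequences and sub-sequences), §5.2 Thm. 24 (ii) [arXiv 0711.4948: Thm. 23] [Nolin2008].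
* W. Werner, *Lectures on two-dimensional critical percolation*, IAS/Park City Math. Ser. 16
  (2009), Lecture 6, §3 (five arms) [WernerPCMI2009].

## Mathlib / tree

Tree: `armEvent`, `adjFourArmCyc`, `HexSep`, `HexBtw`, `hexSep_symm`, `hexPos`,
`hexPos_ne_of_disjoint`, `mem_triSphere_iff`.
-/

noncomputable section

open MeasureTheory Set

namespace Literature.Probability.Percolation

open LatticeModels

/-- Pigeonhole on three propositions: two of them are equivalent. [folklore] -/
theorem exists_pair_iff_of_three (P : Fin 3 → Prop) : ∃ i j : Fin 3, i ≠ j ∧ (P i ↔ P j) := by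
  by_cases h0 : P 0 <;> by_cases h1 : P 1 <;> by_cases h2 : P 2
  all_goals first
    | exact ⟨0, 1, by decide, iff_of_true h0 h1⟩
    | exact ⟨0, 1, by decide, iff_of_false h0 h1⟩
    | exact ⟨0, 2, by decide, iff_of_true h0 h2⟩
    | exact ⟨0, 2, by decide, iff_of_false h0 h2⟩
    | exact ⟨1, 2, by decide, iff_of_true h1 h2⟩
    | exact ⟨1, 2, by decide, iff_of_false h1 h2⟩

/-- The closed indices `1, 3, 4` of `![T,F,T,F,F]`: injective, avoiding `0, 2`, of colour `F`. [folklore] -/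
theorem closedIdx_aux :
    (∀ i i' : Fin 3, (![1, 3, 4] : Fin 3 → Fin 5) i = (![1, 3, 4] : Fin 3 → Fin 5) i' → i = i') ∧
      (∀ i, (![1, 3, 4] : Fin 3 → Fin 5) i ≠ 0) ∧
      (∀ i, (![1, 3, 4] : Fin 3 → Fin 5) i ≠ 2) ∧
      (∀ i, (![true, false, true, false, false] : Fin 5 → Bool) ((![1, 3, 4] : Fin 3 → Fin 5) i) = false) := by
  decide

/-- The reindexing `(0, a, 2, b)` is injective for distinct `a, b ∉ {0, 2}`. [folklore] -/
theorem reindex_injective_aux : ∀ a b : Fin 5, a ≠ 0 → a ≠ 2 → b ≠ 0 → b ≠ 2 → a ≠ b →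
    ∀ j j' : Fin 4, (![0, a, 2, b] : Fin 4 → Fin 5) j = (![0, a, 2, b] : Fin 4 → Fin 5) j' → j = j' := by
  decide

/-- The reindexing `(0, a, 2, b)` has colours `T,F,T,F` when `a, b` are closed indices. [folklore] -/
theorem reindex_colour_aux : ∀ a b : Fin 5, (![true, false, true, false, false] : Fin 5 → Bool) a = false →
    (![true, false, true, false, false] : Fin 5 → Bool) b = false →
    ∀ j, (![true, false, true, false, false] : Fin 5 → Bool) ((![0, a, 2, b] : Fin 4 → Fin 5) j) =
      (![true, false, true, false] : Fin 4 → Bool) j := by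
  decide

/-- **Two of three points lie on the same side of a pair**: if `c₁, c₂, c₃` are compared with
the pair `{a, b}` for "strictly between", two of them have the same status, and then `{a, b}` does
not separate them. [folklore] -/
theorem not_hexSep_of_same_side {a b c d : ℤ} (h : HexBtw a b c ↔ HexBtw a b d) :
    ¬ HexSep a b c d := by
  unfold HexSep; tauto

/-- **Five arms with colours `T,F,T,F,F` contain four cyclically adjacent arms** (`1 ≤ R`):
`armEvent ![T,F,T,F,F] r R ⊆ adjFourArmCyc r R`. [cite: Nolin2008, §4.1 (sub-sequences of a colour sequence; arXiv 0711.4948)] -/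
theorem armEvent_five_subset_adjFourArmCyc {r R : ℕ} (hR : 1 ≤ R) :
    armEvent ![true, false, true, false, false] r R ⊆ adjFourArmCyc r R := by
  classical
  rintro ω ⟨x, y, w, hw, hdisj⟩
  -- the three closed arms, and two of them on the same side of the open pair
  set cl : Fin 3 → Fin 5 := ![1, 3, 4] with hcl
  obtain ⟨hcl_inj, hcl_ne0, hcl_ne2, hcl_col⟩ := closedIdx_aux
  rw [← hcl] at hcl_inj hcl_ne0 hcl_ne2 hcl_col
  set p : Fin 5 → ℤ := fun j => hexPos R (y j) with hp
  obtain ⟨i, i', hii', hside'⟩ := exists_pair_iff_of_three fun k => HexBtw (p 0) (p 2) (p (cl k))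
  -- the reindexing `τ = (0, cl i, 2, cl i')`
  set τ : Fin 4 → Fin 5 := ![0, cl i, 2, cl i'] with hτ
  have hτ_inj : Function.Injective τ := fun j j' h =>
    reindex_injective_aux _ _ (hcl_ne0 i) (hcl_ne2 i) (hcl_ne0 i') (hcl_ne2 i') (fun h => hii' (hcl_inj _ _ h))
      j j' h
  have hcolτ : ∀ j, (![true, false, true, false, false] : Fin 5 → Bool) (τ j) =
      (![true, false, true, false] : Fin 4 → Bool) j :=
    reindex_colour_aux _ _ (hcl_col i) (hcl_col i')
  refine ⟨fun j => x (τ j), fun j => y (τ j), fun j => w (τ j), fun j => ?_, ?_, ?_⟩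
  · obtain ⟨h1, h2, h3, h4, h5⟩ := hw (τ j)
    refine ⟨h1, h2, h3, h4, ?_⟩
    rw [← hcolτ j]; exact h5
  · intro j j' hjj'
    exact hdisj (fun h => hjj' (hτ_inj h))
  · -- the closed extremities `y (cl i)`, `y (cl i')` do not separate the open ones `y 0`, `y 2`
    show ¬ HexSep (p (τ 1)) (p (τ 3)) (p (τ 0)) (p (τ 2))
    have e0 : τ 0 = 0 := rfl
    have e1 : τ 1 = cl i := rfl
    have e2 : τ 2 = 2 := rfl
    have e3 : τ 3 = cl i' := rfl
    rw [e0, e1, e2, e3]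
    intro hsep
    have hyn : ∀ j, triNorm (y j) = R := fun j => mem_triSphere_iff.1 (hw j).2.1
    have hne : ∀ {j j' : Fin 5}, j ≠ j' → p j ≠ p j' := fun {j j'} hjj' =>
      hexPos_ne_of_disjoint hR (hyn j) (hyn j') (hdisj hjj')
    have h := hexSep_symm (hne (hcl_ne0 i)) (hne (hcl_ne2 i)) (hne (hcl_ne0 i')) (hne (hcl_ne2 i')) hsep
    exact not_hexSep_of_same_side hside' h

end Literature.Probability.Percolation
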